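import Summits.QuantumFields.YangMills.Theorems.UnitScaleTiltProp7DbarLinCovDefect
import Summits.QuantumFields.YangMills.Theorems.UnitScaleTiltProp8ChartDoubleBarDeriv
import Summits.QuantumFields.YangMills.Theorems.UnitScaleTiltProp7TubeAverageL1Damping
import Summits.QuantumFields.YangMills.Theorems.UnitScaleTiltProp7TwistedOneStepDefectFlat
import HarnessLib

/-!
# Route `UnitScaleTilt`, crux K1 «MinimiserStabilityRegPr» (stmt-QuantumFields-19200), route-R E′ (A′) «HCOW-VIA-Σ» (★★OWNER RULING g28-№13), package P-A2 «JOINT-Σ»,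
# row F2″-COV (★p1 g17 NAMER WORD 16 (c)), FILE C — **THE ℓ¹ DAMPING OF THE COVARIANT ONE-STEP LINEARISATION**: at a level-`j` background `V₀` which, for every
# coarse bond `c`, some norm-`≤ 1` gauge `û_c` makes `s_B`-flat on the two blocks of `c`, the linear part `T := Df(0)` of the one-step twisted-average chart
# `f(A)(c) = log[U̿(V₀; e^{A}V₀)(c)·Ū(V₀)(c)⁻¹]` has column sums `Σ_c ‖(T Y)(c)‖ ≤ (L·L^{−d} + C_F·2s_B·2d)·Σ_b ‖Y b‖`, `C_F = 16·(12Lρ)∕ρ²` —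
# the `hT`∕`κ_m` letter of px18 g3's F0″-a ✓`IteratedMapTelescope.l1_iterate_sub_fderiv_zero_le_prod` at a CURVED background (at `V₀ = 1`: `L^{1−d}`, ✓p688095).

Cell `ym3-torus`, D-0154 (3c) twin-width seat `ym-routeR-w3` (gen 7).  YM₃ on T³ is a ladder rung (R3), NOT the Clay problem; nothing here is a claim about the stub, the crux,
d = 4 or the mass gap.  `--supports stmt-QuantumFields-19200 --as helper`; count-neutral; def-free.  Matrix algebra `M_n(ℂ)` with the `L²`-operator (C⋆) norm, the currency
of the route's charts (✓`Prop7SymAvgTwSymDefs`, ✓`Prop7CmapTwSymInputs`).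

THE ARGUMENT (all by name).  (1) FLAT: `∂_A|₀ log U̿(e^{A})(c) = L·(QA)(c)` EXACTLY (`Q = bondAvg`; ✓`Prop8ChartDoubleBar.exists_hasFDerivAt_coe_dbarAvgU_flat`: the frames cancel the
comb means of the single-bar linearisation, [Balaban1985Averaging] (125)) and `Σ_c ‖(QZ)(c)‖ ≤ L^{−d}·Σ_b ‖Z b‖` (✓`Prop7TubeAverageL1Damping.sum_norm_bondAvg_le`, applied to the REAL
field `b ↦ ‖Z b‖` after the pointwise triangle inequality `‖(QZ)(c)‖ ≤ (Q‖Z‖)(c)`).  (2) COVARIANT: FILE B ★★★`Prop7DbarLinCovDefect.differentiableAt_dbarLogRel_zero` — at `c` the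
linear part is `T_c⁻¹·(L·Q(Ad_{û_c}Y))(c)·T_c` up to `C_F·2s_B·‖Y‖_sup`; conjugations do not increase norms.  (3) LOCALITY: `f(·)(c)` reads `A` only on the two-block bonds of `c`
(✓`dbarCovU_congr₂`), so `T Y(c) = T Y_c(c)` with `Y_c` the truncation of `Y` to those bonds, whose sup is `≤ Σ_{b read by c} ‖Y b‖`; summing, the multiplicity count
✓`Prop7TwistedOneStepDefectFlat.sum_read_le_two_d_mul` (routeR-w6 g7) gives the factor `2d`.

WHAT THIS FILE PROVES (sorry-free, no definition; `f` INLINE as in routeR-w6 g7's F1″-COV core: `fun A => mlog (↑(dbarCovU V₀ (fun b => expUnit (A b) * V₀ b) c) * ↑(emlAvgU V₀ c)⁻¹)`).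
* §1 ★`fderiv_flatDbarChart_zero_apply` — `fderiv ℂ (A ↦ log U̿(e^{A})(c)) 0 Y = (L : ℂ) • bondAvg Y c`.
* §2 `norm_bondAvg_le_bondAvg_norm`, `bondAvg_mono`, ★`sum_norm_smul_bondAvg_le_of_pointwise` (`Σ_c ‖L•Q(Z_c)(c)‖ ≤ L·L^{−d}·Σ_b‖Y b‖` whenever `‖Z_c b‖ ≤ ‖Y b‖`).
* §3 ★★★ **`sum_norm_fderiv_dbarChart_le`** — the column-sum row above, per-bond gauges `û : PBond P (j+1) → GaugeTransf P j M_n(ℂ)ˣ` displayed; ★★★ **`sum_norm_fderiv_dbarChartField_apply_le`**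
  — the same for the FIELD-valued one-step map `A ↦ (c ↦ f(A)(c))` (`fderiv_pi`), i.e. LITERALLY px18's `hT m` at `T m := fderiv ℂ (f m) 0`, with `differentiableAt_dbarChartField_zero`.
HONEST SCOPE.  Counting + the two landed estimates; constants crude, L-only.  The T³∕`RegPr` reading (the gauges `û_c` = block∕cluster axial gauges of the background tower
`Ū₀ˡ = emlIterU l U₀♭` at each level, `s_{B,l}` geometric in `l`, hence `Π κ ≤ 2·(L^{1−d})^{k−1−l}` under an L-only window) is FILE D.  Nothing of P-A2, hcoW, E′, EX or the crux is claimed.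

References: T. Bałaban, CMP **98** (1985) 17–51 [Balaban1985Averaging] ((89) p.31, (121)–(127) p.36, (150)–(152) p.40); CMP **95** (1984) 17–40 [Balaban1984PropagatorsI] ((1.11),
(1.16)–(1.20) pp.19–20); CMP **102** (1985) 277–309 [Balaban1985Variational] ((44)–(46) p.285).
-/

noncomputable section

open scoped BigOperators Matrix.Norms.L2Operator
open NormedSpace Metric Set Finset

namespace Summit.QuantumFields.YangMills.Theorems.Prop7TwistedOneStepLinL1

open Literature.MathematicalPhysics.QuantumFieldTheory.Balaban1983to89
open T4Continuum BlockAveraging AveragingRT ExpMeanLog LatticeFieldCalculus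
open B7Prop1Explicit (expUnit val_expUnit)
open MatrixLog (mlog mlog_one)
open B7TransferAnalyticMean (hasFDerivAt_mlog_one)
open B10Eq27TorusAxialLog (gaugeActT gaugeActT_apply)
open Summit.QuantumFields.YangMills.Theorems.Prop8Chart (emlAvgU)
open Summit.QuantumFields.YangMills.Theorems.Prop8ChartDoubleBar (dbarAvgU dbarAvgU_one exists_hasFDerivAt_coe_dbarAvgU_flat)
open Summit.QuantumFields.YangMills.Theorems.Prop7SymAvgTwSym (dbarCovU)
open Summit.QuantumFields.YangMills.Theorems.Prop7SymFrameCovLocality (dbarCovU_congr₂)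
open Summit.QuantumFields.YangMills.Theorems.Prop7SymAvgRelativeBound (expUnit_zero')
open Summit.QuantumFields.YangMills.Theorems.Prop7DbarLinCovDefect (differentiableAt_dbarLogRel_zero)
open Summit.QuantumFields.BalabanUV.T4Continuum (NE9RelativeChartPlaquette.norm_conj_le)
open Summit.QuantumFields.YangMills.Theorems.Prop7TubeAverageL1Damping (sum_norm_bondAvg_le)
open Summit.QuantumFields.YangMills.Theorems.Prop7TwistedOneStepDefectFlat (sum_read_le_two_d_mul)

variable {P : Params} {j : ℕ}
variable {n : Type*} [Fintype n] [DecidableEq n] [Nonempty n]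

/-! ## §1 The flat linearisation is the straight tube -/

omit [Nonempty n] in
/-- ★ **THE LINEARISED FLAT DOUBLE BAR IS `L·Q`**: `fderiv ℂ (A ↦ log U̿(e^{A})(c)) 0 Y = (L : ℂ) • bondAvg Y c` — ✓`exists_hasFDerivAt_coe_dbarAvgU_flat` at the family
`A ↦ e^{A}` (`D(e^{A(b)})(0) = proj_b`), then `D log(1) = id`. [cite: Balaban1985Averaging, (125) p.36; Balaban1984PropagatorsI, (1.11) p.19] -/
theorem fderiv_flatDbarChart_zero_apply (c : PBond P (j + 1)) (Y : PBond P j → Matrix n n ℂ) :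
    fderiv ℂ (fun A : PBond P j → Matrix n n ℂ => mlog ((dbarAvgU (fun b => expUnit (A b)) c : (Matrix n n ℂ)ˣ) : Matrix n n ℂ)) 0 Y =
      ((P.L : ℕ) : ℂ) • bondAvg Y c := by
  have hF : ∀ b : PBond P j, HasFDerivAt (fun A : PBond P j → Matrix n n ℂ => ((expUnit (A b) : (Matrix n n ℂ)ˣ) : Matrix n n ℂ))
      (ContinuousLinearMap.proj (R := ℂ) (φ := fun _ : PBond P j => Matrix n n ℂ) b) 0 := by
    intro b
    have hfun : (fun A : PBond P j → Matrix n n ℂ => ((expUnit (A b) : (Matrix n n ℂ)ˣ) : Matrix n n ℂ)) =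
        fun A => exp ((ContinuousLinearMap.proj (R := ℂ) (φ := fun _ : PBond P j => Matrix n n ℂ) b) A) := by
      funext A; rw [val_expUnit]; rfl
    rw [hfun]
    have hexp : HasFDerivAt (exp : Matrix n n ℂ → Matrix n n ℂ) (1 : Matrix n n ℂ →L[ℂ] Matrix n n ℂ)
        ((ContinuousLinearMap.proj (R := ℂ) (φ := fun _ : PBond P j => Matrix n n ℂ) b) 0) := by
      rw [map_zero]; exact hasFDerivAt_exp_zero
    have h := hexp.comp (0 : PBond P j → Matrix n n ℂ) (ContinuousLinearMap.proj (R := ℂ) (φ := fun _ : PBond P j => Matrix n n ℂ) b).hasFDerivAt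
    rwa [ContinuousLinearMap.one_def, ContinuousLinearMap.id_comp] at h
  have h1 : ∀ b : PBond P j, (fun (A : PBond P j → Matrix n n ℂ) (b : PBond P j) => expUnit (A b)) 0 b = 1 := by
    intro b; simp only [Pi.zero_apply, expUnit_zero']
  obtain ⟨D, hD, hDv⟩ := exists_hasFDerivAt_coe_dbarAvgU_flat (F := fun (A : PBond P j → Matrix n n ℂ) (b : PBond P j) => expUnit (A b))
    (x₀ := (0 : PBond P j → Matrix n n ℂ)) hF h1 c
  have hflat : (fun b : PBond P j => expUnit ((0 : PBond P j → Matrix n n ℂ) b)) = fun _ => (1 : (Matrix n n ℂ)ˣ) := by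
    funext b; simp only [Pi.zero_apply, expUnit_zero']
  have hval : ((dbarAvgU (fun b : PBond P j => expUnit ((0 : PBond P j → Matrix n n ℂ) b)) c : (Matrix n n ℂ)ˣ) : Matrix n n ℂ) = 1 := by
    rw [hflat, dbarAvgU_one, Units.val_one]
  have hlog : HasFDerivAt (mlog : Matrix n n ℂ → Matrix n n ℂ) (1 : Matrix n n ℂ →L[ℂ] Matrix n n ℂ)
      ((dbarAvgU (fun b : PBond P j => expUnit ((0 : PBond P j → Matrix n n ℂ) b)) c : (Matrix n n ℂ)ˣ) : Matrix n n ℂ) := by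
    rw [hval]; exact hasFDerivAt_mlog_one
  have hcomp := hlog.comp (0 : PBond P j → Matrix n n ℂ) hD
  rw [ContinuousLinearMap.one_def, ContinuousLinearMap.id_comp] at hcomp
  have hcomp' : HasFDerivAt (fun A : PBond P j → Matrix n n ℂ => mlog ((dbarAvgU (fun b => expUnit (A b)) c : (Matrix n n ℂ)ˣ) : Matrix n n ℂ)) D 0 :=
    hcomp
  rw [hcomp'.fderiv, hDv]
  rfl

/-! ## §2 The tube average: pointwise triangle inequality, monotonicity, the rotated column sum -/

omit [Nonempty n] in
/-- `‖(QZ)(c)‖ ≤ (Q‖Z‖)(c)`: the tube average is a nonnegative-weight average. [cite: Balaban1984PropagatorsI, (1.11) p.19] -/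
theorem norm_bondAvg_le_bondAvg_norm (Z : PBond P j → Matrix n n ℂ) (c : PBond P (j + 1)) :
    ‖bondAvg Z c‖ ≤ bondAvg (fun b => ‖Z b‖) c := by
  show ‖(((P.L : ℝ) ^ (P.d + 1))⁻¹) • ∑ r : Fin P.d → Fin P.L, segSum Z (Site.blockSite c.src r) c.dir P.L‖ ≤
    (((P.L : ℝ) ^ (P.d + 1))⁻¹) • ∑ r : Fin P.d → Fin P.L, segSum (fun b => ‖Z b‖) (Site.blockSite c.src r) c.dir P.L
  rw [norm_smul, Real.norm_of_nonneg (by positivity), smul_eq_mul]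
  refine mul_le_mul_of_nonneg_left ((norm_sum_le _ _).trans (Finset.sum_le_sum fun r _ => ?_)) (by positivity)
  show ‖∑ t ∈ Finset.range P.L, Z (runBond (Site.blockSite c.src r) c.dir t)‖ ≤ ∑ t ∈ Finset.range P.L, ‖Z (runBond (Site.blockSite c.src r) c.dir t)‖
  exact norm_sum_le _ _

/-- The tube average of real fields is monotone. [cite: Balaban1984PropagatorsI, (1.11) p.19] -/
theorem bondAvg_mono {g g' : PBond P j → ℝ} (h : ∀ b, g b ≤ g' b) (c : PBond P (j + 1)) : bondAvg g c ≤ bondAvg g' c := by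
  show (((P.L : ℝ) ^ (P.d + 1))⁻¹) • ∑ r : Fin P.d → Fin P.L, segSum g (Site.blockSite c.src r) c.dir P.L ≤
    (((P.L : ℝ) ^ (P.d + 1))⁻¹) • ∑ r : Fin P.d → Fin P.L, segSum g' (Site.blockSite c.src r) c.dir P.L
  rw [smul_eq_mul, smul_eq_mul]
  refine mul_le_mul_of_nonneg_left (Finset.sum_le_sum fun r _ => ?_) (by positivity)
  exact Finset.sum_le_sum fun t _ => h _

/-- The tube average of a nonnegative real field is nonnegative. [cite: Balaban1984PropagatorsI, (1.11) p.19] -/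
theorem bondAvg_nonneg {g : PBond P j → ℝ} (h : ∀ b, 0 ≤ g b) (c : PBond P (j + 1)) : 0 ≤ bondAvg g c := by
  show 0 ≤ (((P.L : ℝ) ^ (P.d + 1))⁻¹) • ∑ r : Fin P.d → Fin P.L, segSum g (Site.blockSite c.src r) c.dir P.L
  rw [smul_eq_mul]
  exact mul_nonneg (by positivity) (Finset.sum_nonneg fun r _ => Finset.sum_nonneg fun t _ => h _)

omit [Nonempty n] in
/-- ★ **THE ROTATED∕TRUNCATED COLUMN SUM OF THE TUBE**: if `‖Z_c(b)‖ ≤ ‖Y(b)‖` for every coarse `c` and fine `b` (e.g. `Z_c = Ad_{û_c}` of a truncation of `Y`), then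
`Σ_c ‖L•(QZ_c)(c)‖ ≤ L·L^{−d}·Σ_b ‖Y b‖` (✓`sum_norm_bondAvg_le` on the real field `‖Y ·‖`). [cite: Balaban1984PropagatorsI, (1.11), (1.18) pp.19–20] -/
theorem sum_norm_smul_bondAvg_le_of_pointwise (hj : j + 1 ≤ P.m + P.K) (Z : PBond P (j + 1) → PBond P j → Matrix n n ℂ) (Y : PBond P j → Matrix n n ℂ)
    (hZ : ∀ c b, ‖Z c b‖ ≤ ‖Y b‖) :
    ∑ c : PBond P (j + 1), ‖((P.L : ℕ) : ℂ) • bondAvg (Z c) c‖ ≤ (P.L : ℝ) * ((P.L : ℝ) ^ P.d)⁻¹ * ∑ b : PBond P j, ‖Y b‖ := by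
  have hpt : ∀ c : PBond P (j + 1), ‖((P.L : ℕ) : ℂ) • bondAvg (Z c) c‖ ≤ (P.L : ℝ) * bondAvg (fun b => ‖Y b‖) c := by
    intro c
    rw [norm_smul, Complex.norm_natCast]
    exact mul_le_mul_of_nonneg_left ((norm_bondAvg_le_bondAvg_norm (Z c) c).trans (bondAvg_mono (hZ c) c)) (Nat.cast_nonneg _)
  have hreal := sum_norm_bondAvg_le (V := ℝ) hj (fun b : PBond P j => ‖Y b‖)
  have habs : ∀ c : PBond P (j + 1), ‖bondAvg (fun b : PBond P j => ‖Y b‖) c‖ = bondAvg (fun b : PBond P j => ‖Y b‖) c :=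
    fun c => Real.norm_of_nonneg (bondAvg_nonneg (fun b => norm_nonneg _) c)
  simp only [habs, norm_norm] at hreal
  calc ∑ c : PBond P (j + 1), ‖((P.L : ℕ) : ℂ) • bondAvg (Z c) c‖
      ≤ ∑ c : PBond P (j + 1), (P.L : ℝ) * bondAvg (fun b => ‖Y b‖) c := Finset.sum_le_sum fun c _ => hpt c
    _ = (P.L : ℝ) * ∑ c : PBond P (j + 1), bondAvg (fun b => ‖Y b‖) c := by rw [Finset.mul_sum]
    _ ≤ (P.L : ℝ) * (((P.L : ℝ) ^ P.d)⁻¹ * ∑ b : PBond P j, ‖Y b‖) := mul_le_mul_of_nonneg_left hreal (Nat.cast_nonneg _)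
    _ = (P.L : ℝ) * ((P.L : ℝ) ^ P.d)⁻¹ * ∑ b : PBond P j, ‖Y b‖ := by ring

/-! ## §3 ★★★ The column sum of the covariant one-step linearisation -/

/-- ★★★ **THE ℓ¹ DAMPING OF THE COVARIANT ONE-STEP LINEARISATION.**  Level-`j` background `V₀`; for every coarse bond `c` a norm-`≤ 1` gauge `û_c` making `V₀` `s_B`-flat on the two
blocks of `c`; one-step budget `10⁷ℓ²ρ ≤ 1`, `4s_B < ρ`.  Then for every `Y`
`Σ_c ‖∂_A|₀ log[U̿(V₀; e^{A}V₀)(c)·Ū(V₀)(c)⁻¹]·Y‖ ≤ (L·L^{−d} + 16·(12Lρ)∕ρ²·(2s_B)·(2d))·Σ_b ‖Y b‖`.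
[cite: Balaban1985Averaging, (125)-(127) p.36, (150)-(152) p.40; Balaban1984PropagatorsI, (1.18)-(1.20) pp.19-20; Balaban1985Variational, (44)-(46) p.285] -/
theorem sum_norm_fderiv_dbarChart_le (hj : j + 1 ≤ P.m + P.K) (V₀ : GaugeField P j (Matrix n n ℂ)ˣ)
    (û : PBond P (j + 1) → GaugeTransf P j (Matrix n n ℂ)ˣ)
    (hû : ∀ c x, ‖((û c x : (Matrix n n ℂ)ˣ) : Matrix n n ℂ)‖ ≤ 1) (hû' : ∀ c x, ‖(((û c x)⁻¹ : (Matrix n n ℂ)ˣ) : Matrix n n ℂ)‖ ≤ 1)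
    {sB ρ : ℝ} (hρ0 : 0 < ρ) (hbudget : 10000000 * (((P.d + 2) * P.L : ℕ) : ℝ) ^ 2 * ρ ≤ 1) (hsB0 : 0 ≤ sB) (hsB : 4 * sB < ρ)
    (hV : ∀ (c : PBond P (j + 1)) (b : PBond P j), (blockOf b.src = c.src ∨ blockOf b.src = c.tgt) → (blockOf b.tgt = c.src ∨ blockOf b.tgt = c.tgt) →
      ‖((gaugeActT (û c) V₀ b : (Matrix n n ℂ)ˣ) : Matrix n n ℂ) - 1‖ ≤ sB)
    (Y : PBond P j → Matrix n n ℂ) :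
    ∑ c : PBond P (j + 1), ‖fderiv ℂ (fun A : PBond P j → Matrix n n ℂ =>
        mlog (((dbarCovU V₀ (fun b => expUnit (A b) * V₀ b) c : (Matrix n n ℂ)ˣ) : Matrix n n ℂ) *
          (((emlAvgU V₀ c)⁻¹ : (Matrix n n ℂ)ˣ) : Matrix n n ℂ))) 0 Y‖ ≤
      ((P.L : ℝ) * ((P.L : ℝ) ^ P.d)⁻¹ + 16 * (12 * (P.L : ℝ) * ρ) / ρ ^ 2 * (2 * sB) * (2 * P.d)) * ∑ b : PBond P j, ‖Y b‖ := by
  classical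
  -- the two-block predicate, the truncations, the rotated truncations
  set TB : PBond P (j + 1) → PBond P j → Prop := fun c b =>
    (blockOf b.src = c.src ∨ blockOf b.src = c.tgt) ∧ (blockOf b.tgt = c.src ∨ blockOf b.tgt = c.tgt) with hTB
  set Yc : PBond P (j + 1) → PBond P j → Matrix n n ℂ := fun c b => if TB c b then Y b else 0 with hYc
  set Z : PBond P (j + 1) → PBond P j → Matrix n n ℂ := fun c b =>
    ((û c b.src : (Matrix n n ℂ)ˣ) : Matrix n n ℂ) * Yc c b * (((û c b.src)⁻¹ : (Matrix n n ℂ)ˣ) : Matrix n n ℂ) with hZ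
  have hYcb : ∀ c b, ‖Yc c b‖ ≤ ‖Y b‖ := by
    intro c b; by_cases h : TB c b
    · simp only [hYc, h, if_true]; exact le_rfl
    · simp only [hYc, h, if_false, norm_zero]; exact norm_nonneg _
  have hZb : ∀ c b, ‖Z c b‖ ≤ ‖Y b‖ := fun c b => (NE9RelativeChartPlaquette.norm_conj_le (hû c b.src) (hû' c b.src)).trans (hYcb c b)
  -- the sup of the truncation is at most the sum over the read set
  have hYcsup : ∀ c, ‖Yc c‖ ≤ ∑ b ∈ (univ.filter fun b : PBond P j => TB c b), ‖Y b‖ := by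
    intro c
    refine (pi_norm_le_iff_of_nonneg (Finset.sum_nonneg fun b _ => norm_nonneg _)).2 fun b => ?_
    by_cases h : TB c b
    · simp only [hYc, h, if_true]
      exact Finset.single_le_sum (f := fun b => ‖Y b‖) (fun b _ => norm_nonneg _) (Finset.mem_filter.2 ⟨Finset.mem_univ _, h⟩)
    · simp only [hYc, h, if_false, norm_zero]
      exact Finset.sum_nonneg fun b _ => norm_nonneg _
  -- per coarse bond: locality (truncation), FILE B, the flat identification
  have hpt : ∀ c : PBond P (j + 1), ‖fderiv ℂ (fun A : PBond P j → Matrix n n ℂ =>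
        mlog (((dbarCovU V₀ (fun b => expUnit (A b) * V₀ b) c : (Matrix n n ℂ)ˣ) : Matrix n n ℂ) *
          (((emlAvgU V₀ c)⁻¹ : (Matrix n n ℂ)ˣ) : Matrix n n ℂ))) 0 Y‖ ≤
      ‖((P.L : ℕ) : ℂ) • bondAvg (Z c) c‖ + 16 * (12 * (P.L : ℝ) * ρ) / ρ ^ 2 * (2 * sB) * ∑ b ∈ (univ.filter fun b : PBond P j => TB c b), ‖Y b‖ := by
    intro c
    set f : (PBond P j → Matrix n n ℂ) → Matrix n n ℂ := fun A =>
      mlog (((dbarCovU V₀ (fun b => expUnit (A b) * V₀ b) c : (Matrix n n ℂ)ˣ) : Matrix n n ℂ) *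
        (((emlAvgU V₀ c)⁻¹ : (Matrix n n ℂ)ˣ) : Matrix n n ℂ)) with hf
    obtain ⟨hdiff, hrow⟩ := differentiableAt_dbarLogRel_zero hj c V₀ (û c) (hû c) (hû' c) hρ0 hbudget hsB0 hsB (hV c)
    -- the truncation as a continuous linear map
    set π : (PBond P j → Matrix n n ℂ) →L[ℂ] (PBond P j → Matrix n n ℂ) :=
      ContinuousLinearMap.pi fun b : PBond P j =>
        if TB c b then ContinuousLinearMap.proj (R := ℂ) (φ := fun _ : PBond P j => Matrix n n ℂ) b else 0 with hπ
    have hπ_apply : ∀ A : PBond P j → Matrix n n ℂ, π A = fun b => if TB c b then A b else 0 := by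
      intro A; funext b
      simp only [hπ, ContinuousLinearMap.pi_apply]
      split_ifs <;> rfl
    have hπY : π Y = Yc c := by rw [hπ_apply]
    -- locality: `f = f ∘ π`
    have hloc : f = f ∘ π := by
      funext A
      simp only [Function.comp_apply, hf]
      rw [dbarCovU_congr₂ hj V₀ c (W' := fun b => expUnit ((π A) b) * V₀ b) fun b hbs hbt => by
        rw [hπ_apply]; simp only [hTB, hbs, hbt, and_self, if_true]]
    have hπ0 : π 0 = 0 := map_zero π
    have h1 : HasFDerivAt f (fderiv ℂ f 0) (π 0) := by rw [hπ0]; exact hdiff.hasFDerivAt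
    have h2 : HasFDerivAt (f ∘ π) ((fderiv ℂ f 0).comp π) 0 := h1.comp 0 π.hasFDerivAt
    have hfd : fderiv ℂ f 0 Y = fderiv ℂ f 0 (Yc c) := by
      conv_lhs => rw [hloc]
      rw [h2.fderiv, ContinuousLinearMap.comp_apply, hπY]
    rw [hfd]
    -- FILE B on the truncated field, the flat identification, isometry of the conjugation
    have hr := hrow (Yc c)
    rw [fderiv_flatDbarChart_zero_apply] at hr
    have hAd : (fun b : PBond P j => ((û c b.src : (Matrix n n ℂ)ˣ) : Matrix n n ℂ) * Yc c b * (((û c b.src)⁻¹ : (Matrix n n ℂ)ˣ) : Matrix n n ℂ)) = Z c := rfl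
    rw [hAd] at hr
    have hmain : ‖(((û c (emb c.src))⁻¹ : (Matrix n n ℂ)ˣ) : Matrix n n ℂ) * (((P.L : ℕ) : ℂ) • bondAvg (Z c) c) *
        ((û c (emb c.src) : (Matrix n n ℂ)ˣ) : Matrix n n ℂ)‖ ≤ ‖((P.L : ℕ) : ℂ) • bondAvg (Z c) c‖ :=
      NE9RelativeChartPlaquette.norm_conj_le (hû' c (emb c.src)) (hû c (emb c.src))
    have hC0 : 0 ≤ 16 * (12 * (P.L : ℝ) * ρ) / ρ ^ 2 * (2 * sB) := by positivity
    calc ‖fderiv ℂ f 0 (Yc c)‖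
        ≤ ‖(((û c (emb c.src))⁻¹ : (Matrix n n ℂ)ˣ) : Matrix n n ℂ) * (((P.L : ℕ) : ℂ) • bondAvg (Z c) c) * ((û c (emb c.src) : (Matrix n n ℂ)ˣ) : Matrix n n ℂ)‖ +
          ‖fderiv ℂ f 0 (Yc c) - (((û c (emb c.src))⁻¹ : (Matrix n n ℂ)ˣ) : Matrix n n ℂ) * (((P.L : ℕ) : ℂ) • bondAvg (Z c) c) *
            ((û c (emb c.src) : (Matrix n n ℂ)ˣ) : Matrix n n ℂ)‖ := norm_le_insert' _ _
      _ ≤ ‖((P.L : ℕ) : ℂ) • bondAvg (Z c) c‖ + 16 * (12 * (P.L : ℝ) * ρ) / ρ ^ 2 * (2 * sB) * ‖Yc c‖ := add_le_add hmain hr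
      _ ≤ ‖((P.L : ℕ) : ℂ) • bondAvg (Z c) c‖ + 16 * (12 * (P.L : ℝ) * ρ) / ρ ^ 2 * (2 * sB) * ∑ b ∈ (univ.filter fun b : PBond P j => TB c b), ‖Y b‖ := by
          have := mul_le_mul_of_nonneg_left (hYcsup c) hC0; linarith
  -- summation: the rotated tube column sum + the read-set multiplicity
  have htube := sum_norm_smul_bondAvg_le_of_pointwise hj Z Y hZb
  have hread := sum_read_le_two_d_mul (P := P) (j := j) (fun b => ‖Y b‖) (fun b => norm_nonneg _)
  have hC0 : 0 ≤ 16 * (12 * (P.L : ℝ) * ρ) / ρ ^ 2 * (2 * sB) := by positivity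
  calc ∑ c : PBond P (j + 1), ‖fderiv ℂ (fun A : PBond P j → Matrix n n ℂ =>
        mlog (((dbarCovU V₀ (fun b => expUnit (A b) * V₀ b) c : (Matrix n n ℂ)ˣ) : Matrix n n ℂ) *
          (((emlAvgU V₀ c)⁻¹ : (Matrix n n ℂ)ˣ) : Matrix n n ℂ))) 0 Y‖
      ≤ ∑ c : PBond P (j + 1), (‖((P.L : ℕ) : ℂ) • bondAvg (Z c) c‖ +
          16 * (12 * (P.L : ℝ) * ρ) / ρ ^ 2 * (2 * sB) * ∑ b ∈ (univ.filter fun b : PBond P j => TB c b), ‖Y b‖) := Finset.sum_le_sum fun c _ => hpt c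
    _ = ∑ c : PBond P (j + 1), ‖((P.L : ℕ) : ℂ) • bondAvg (Z c) c‖ +
          16 * (12 * (P.L : ℝ) * ρ) / ρ ^ 2 * (2 * sB) * ∑ c : PBond P (j + 1), ∑ b ∈ (univ.filter fun b : PBond P j => TB c b), ‖Y b‖ := by
        rw [Finset.sum_add_distrib, Finset.mul_sum]
    _ ≤ (P.L : ℝ) * ((P.L : ℝ) ^ P.d)⁻¹ * ∑ b : PBond P j, ‖Y b‖ + 16 * (12 * (P.L : ℝ) * ρ) / ρ ^ 2 * (2 * sB) * (2 * P.d * ∑ b : PBond P j, ‖Y b‖) :=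
        add_le_add htube (mul_le_mul_of_nonneg_left hread hC0)
    _ = ((P.L : ℝ) * ((P.L : ℝ) ^ P.d)⁻¹ + 16 * (12 * (P.L : ℝ) * ρ) / ρ ^ 2 * (2 * sB) * (2 * P.d)) * ∑ b : PBond P j, ‖Y b‖ := by ring

/-- **THE FIELD-VALUED ONE-STEP CHART IS DIFFERENTIABLE AT `0`** (componentwise by FILE B). [cite: Balaban1985Averaging, (127) p.36; Balaban1987RG1, (0.4) p.253] -/
theorem differentiableAt_dbarChartField_zero (hj : j + 1 ≤ P.m + P.K) (V₀ : GaugeField P j (Matrix n n ℂ)ˣ)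
    (û : PBond P (j + 1) → GaugeTransf P j (Matrix n n ℂ)ˣ)
    (hû : ∀ c x, ‖((û c x : (Matrix n n ℂ)ˣ) : Matrix n n ℂ)‖ ≤ 1) (hû' : ∀ c x, ‖(((û c x)⁻¹ : (Matrix n n ℂ)ˣ) : Matrix n n ℂ)‖ ≤ 1)
    {sB ρ : ℝ} (hρ0 : 0 < ρ) (hbudget : 10000000 * (((P.d + 2) * P.L : ℕ) : ℝ) ^ 2 * ρ ≤ 1) (hsB0 : 0 ≤ sB) (hsB : 4 * sB < ρ)
    (hV : ∀ (c : PBond P (j + 1)) (b : PBond P j), (blockOf b.src = c.src ∨ blockOf b.src = c.tgt) → (blockOf b.tgt = c.src ∨ blockOf b.tgt = c.tgt) →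
      ‖((gaugeActT (û c) V₀ b : (Matrix n n ℂ)ˣ) : Matrix n n ℂ) - 1‖ ≤ sB) :
    DifferentiableAt ℂ (fun (A : PBond P j → Matrix n n ℂ) (c : PBond P (j + 1)) =>
        mlog (((dbarCovU V₀ (fun b => expUnit (A b) * V₀ b) c : (Matrix n n ℂ)ˣ) : Matrix n n ℂ) *
          (((emlAvgU V₀ c)⁻¹ : (Matrix n n ℂ)ˣ) : Matrix n n ℂ))) 0 :=
  differentiableAt_pi.2 fun c => (differentiableAt_dbarLogRel_zero hj c V₀ (û c) (hû c) (hû' c) hρ0 hbudget hsB0 hsB (hV c)).1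

/-- ★★★ **THE SAME FOR THE FIELD-VALUED ONE-STEP MAP** `A ↦ (c ↦ log[U̿(V₀; e^{A}V₀)(c)·Ū(V₀)(c)⁻¹])` — LITERALLY the `hT m` letter of ✓`IteratedMapTelescope.l1_iterate_sub_fderiv_zero_le_prod`
at `T m := fderiv ℂ (f m) 0`: `Σ_c ‖(fderiv ℂ f 0 Y) c‖ ≤ κ·Σ_b ‖Y b‖`, `κ = L·L^{−d} + 16·(12Lρ)∕ρ²·(2s_B)·(2d)` (`fderiv_pi`).
[cite: Balaban1985Averaging, (125)-(127) p.36, (150)-(152) p.40; Balaban1984PropagatorsI, (1.18)-(1.20) pp.19-20] -/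
theorem sum_norm_fderiv_dbarChartField_apply_le (hj : j + 1 ≤ P.m + P.K) (V₀ : GaugeField P j (Matrix n n ℂ)ˣ)
    (û : PBond P (j + 1) → GaugeTransf P j (Matrix n n ℂ)ˣ)
    (hû : ∀ c x, ‖((û c x : (Matrix n n ℂ)ˣ) : Matrix n n ℂ)‖ ≤ 1) (hû' : ∀ c x, ‖(((û c x)⁻¹ : (Matrix n n ℂ)ˣ) : Matrix n n ℂ)‖ ≤ 1)
    {sB ρ : ℝ} (hρ0 : 0 < ρ) (hbudget : 10000000 * (((P.d + 2) * P.L : ℕ) : ℝ) ^ 2 * ρ ≤ 1) (hsB0 : 0 ≤ sB) (hsB : 4 * sB < ρ)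
    (hV : ∀ (c : PBond P (j + 1)) (b : PBond P j), (blockOf b.src = c.src ∨ blockOf b.src = c.tgt) → (blockOf b.tgt = c.src ∨ blockOf b.tgt = c.tgt) →
      ‖((gaugeActT (û c) V₀ b : (Matrix n n ℂ)ˣ) : Matrix n n ℂ) - 1‖ ≤ sB)
    (Y : PBond P j → Matrix n n ℂ) :
    ∑ c : PBond P (j + 1), ‖(fderiv ℂ (fun (A : PBond P j → Matrix n n ℂ) (c : PBond P (j + 1)) =>
        mlog (((dbarCovU V₀ (fun b => expUnit (A b) * V₀ b) c : (Matrix n n ℂ)ˣ) : Matrix n n ℂ) *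
          (((emlAvgU V₀ c)⁻¹ : (Matrix n n ℂ)ˣ) : Matrix n n ℂ))) 0 Y) c‖ ≤
      ((P.L : ℝ) * ((P.L : ℝ) ^ P.d)⁻¹ + 16 * (12 * (P.L : ℝ) * ρ) / ρ ^ 2 * (2 * sB) * (2 * P.d)) * ∑ b : PBond P j, ‖Y b‖ := by
  have hcomp : ∀ c : PBond P (j + 1), DifferentiableAt ℂ (fun A : PBond P j → Matrix n n ℂ =>
      mlog (((dbarCovU V₀ (fun b => expUnit (A b) * V₀ b) c : (Matrix n n ℂ)ˣ) : Matrix n n ℂ) *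
        (((emlAvgU V₀ c)⁻¹ : (Matrix n n ℂ)ˣ) : Matrix n n ℂ))) 0 :=
    fun c => (differentiableAt_dbarLogRel_zero hj c V₀ (û c) (hû c) (hû' c) hρ0 hbudget hsB0 hsB (hV c)).1
  rw [fderiv_pi hcomp]
  simp only [ContinuousLinearMap.pi_apply]
  exact sum_norm_fderiv_dbarChart_le hj V₀ û hû hû' hρ0 hbudget hsB0 hsB hV Y

end Summit.QuantumFields.YangMills.Theorems.Prop7TwistedOneStepLinL1

end
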